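import Mathlib

/-!
# Relatively prime bivariate polynomials have finitely many common zeros

Helper file for item stmt-Schanuel-0975 (`TwoLogsBranchRelationFinite`, route RigidCore).
-/

noncomputable section

-- `Summit.Schanuel.Schanuel` is the tree's mandated `Summit.<Summit>.<Problem>` prefix (single-problem summit).
set_option linter.dupNamespace false

open Polynomial

namespace Summit.Schanuel.Schanuel.Theorems.RigidCore.TwoLogs

variable {K : Type*} [Field K]

/-- Gauss-lemma transfer: if `p q : B[X]` over a GCD domain `B` are relatively prime in `B[X]`,
then their images in `Frac(B)[X]` are coprime (Gauss's lemma; folklore). -/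
theorem isCoprime_map_of_isRelPrime {B : Type*} [CommRing B] [IsDomain B] [IsGCDMonoid B]
    {L : Type*} [Field L] [Algebra B L] [IsFractionRing B L]
    {p q : B[X]} (hp : p ≠ 0) (h : IsRelPrime p q) :
    IsCoprime (p.map (algebraMap B L)) (q.map (algebraMap B L)) := by
  letI : NormalizedGCDMonoid B := Classical.arbitrary _
  have hinj : Function.Injective (algebraMap B L) := IsFractionRing.injective B L
  have hp' : p.map (algebraMap B L) ≠ 0 := by
    intro h0
    exact hp ((Polynomial.map_injective _ hinj) (by simpa using h0))
  rw [← isRelPrime_iff_isCoprime]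
  intro d hdp hdq
  have hd0 : d ≠ 0 := by
    rintro rfl
    exact hp' (zero_dvd_iff.mp hdp)
  obtain ⟨b, hbM, hb⟩ := IsLocalization.integerNormalization_spec (nonZeroDivisors B) d
  set d₀ := IsLocalization.integerNormalization (nonZeroDivisors B) d with hd₀
  have hb0 : algebraMap B L b ≠ 0 :=
    IsFractionRing.to_map_ne_zero_of_mem_nonZeroDivisors hbM
  have hunit : IsUnit (Polynomial.C (algebraMap B L b)) := Polynomial.isUnit_C.mpr (Ne.isUnit hb0)
  -- `d₀.map = C (ι b) * d`
  have hmap : d₀.map (algebraMap B L) = Polynomial.C (algebraMap B L b) * d := by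
    rw [hb, Algebra.smul_def, Polynomial.algebraMap_apply]
  have hd₀p : d₀.map (algebraMap B L) ∣ p.map (algebraMap B L) := by
    rw [hmap]; exact (hunit.mul_left_dvd).mpr hdp
  have hd₀q : d₀.map (algebraMap B L) ∣ q.map (algebraMap B L) := by
    rw [hmap]; exact (hunit.mul_left_dvd).mpr hdq
  have hprim : d₀.primPart.IsPrimitive := Polynomial.isPrimitive_primPart d₀
  have h1 : d₀.primPart ∣ p :=
    hprim.dvd_of_fraction_map_dvd_fraction_map
      ((Polynomial.map_dvd _ d₀.primPart_dvd).trans hd₀p)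
  have h2 : d₀.primPart ∣ q :=
    hprim.dvd_of_fraction_map_dvd_fraction_map
      ((Polynomial.map_dvd _ d₀.primPart_dvd).trans hd₀q)
  have hu : IsUnit d₀.primPart := h h1 h2
  exact Polynomial.isUnit_or_eq_zero_of_isUnit_integerNormalization_primPart hd0 hu


/-- The zero set of a nonzero polynomial in one variable (as `MvPolynomial (Fin 1) K`) is finite. -/
theorem finite_zeros_fin_one {r : MvPolynomial (Fin 1) K} (hr : r ≠ 0) :
    {s : Fin 1 → K | MvPolynomial.eval s r = 0}.Finite := by
  set P : K[X] := Polynomial.map (MvPolynomial.eval (Fin.elim0 : Fin 0 → K))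
    (MvPolynomial.finSuccEquiv K 0 r) with hP
  have hinj : Function.Injective (MvPolynomial.eval (Fin.elim0 : Fin 0 → K)) := by
    intro f g hfg
    rw [MvPolynomial.eq_C_of_isEmpty f, MvPolynomial.eq_C_of_isEmpty g] at hfg ⊢
    simpa using hfg
  have hP0 : P ≠ 0 := by
    intro h0
    apply hr
    apply (MvPolynomial.finSuccEquiv K 0).injective
    rw [map_zero]
    exact (Polynomial.map_injective _ hinj) (by simpa [hP] using h0)
  have hfin : {y : K | P.IsRoot y}.Finite := Polynomial.finite_setOf_isRoot hP0
  refine (hfin.image (fun y : K => (Fin.cons y Fin.elim0 : Fin 1 → K))).subset ?_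
  intro s hs
  refine ⟨s 0, ?_, ?_⟩
  · have : s = Fin.cons (s 0) (Fin.elim0 : Fin 0 → K) := by
      funext i; fin_cases i; rfl
    simp only [Set.mem_setOf_eq] at hs ⊢
    rw [this, MvPolynomial.eval_eq_eval_mv_eval'] at hs
    exact hs
  · have : s = Fin.cons (s 0) (Fin.elim0 : Fin 0 → K) := by
      funext i; fin_cases i; rfl
    exact this.symm

/-- Eliminant: for relatively prime `p q` in `K[X₀,X₁]` with `p ≠ 0` there is a nonzero
`r ∈ K[X₁]` (as `MvPolynomial (Fin 1) K`) vanishing at the tail of every common zero (folklore: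
the resultant). -/
theorem exists_eliminant {p q : MvPolynomial (Fin 2) K} (hp : p ≠ 0) (h : IsRelPrime p q) :
    ∃ r : MvPolynomial (Fin 1) K, r ≠ 0 ∧ ∀ (y : K) (s : Fin 1 → K),
      MvPolynomial.eval (Fin.cons y s) p = 0 → MvPolynomial.eval (Fin.cons y s) q = 0 →
      MvPolynomial.eval s r = 0 := by
  set e := MvPolynomial.finSuccEquiv K 1 with he
  set p' := e p with hp'
  set q' := e q with hq'
  have hp0 : p' ≠ 0 := by
    intro h0
    exact hp (e.injective (by rw [← hp', h0, map_zero]))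
  have h' : IsRelPrime p' q' := by
    refine IsRelPrime.of_map e.symm ?_
    simpa [hp', hq'] using h
  by_cases hdeg : p'.natDegree = 0 ∧ q'.natDegree = 0
  · refine ⟨p'.coeff 0, ?_, ?_⟩
    · intro h0
      apply hp0
      rw [Polynomial.eq_C_of_natDegree_eq_zero hdeg.1, h0, map_zero]
    · intro y s hy _
      rw [MvPolynomial.eval_eq_eval_mv_eval', ← hp',
        Polynomial.eq_C_of_natDegree_eq_zero hdeg.1] at hy
      simpa using hy
  · refine ⟨p'.resultant q' p'.natDegree q'.natDegree, ?_, ?_⟩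
    · intro hr
      let L := FractionRing (MvPolynomial (Fin 1) K)
      have hcop := isCoprime_map_of_isRelPrime (L := L) hp0 h'
      have hinj : Function.Injective (algebraMap (MvPolynomial (Fin 1) K) L) :=
        IsFractionRing.injective _ _
      have hres : (p'.map (algebraMap _ L)).resultant (q'.map (algebraMap _ L)) = 0 := by
        have := Polynomial.resultant_map_map p' q' p'.natDegree q'.natDegree (algebraMap _ L)
        rw [hr, map_zero] at this
        rwa [← Polynomial.natDegree_map_eq_of_injective hinj p',
          ← Polynomial.natDegree_map_eq_of_injective hinj q'] at this
      rw [Polynomial.resultant_eq_zero_iff] at hres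
      exact hres.2 hcop
    · intro y s hy hq
      have hmn : p'.natDegree ≠ 0 ∨ q'.natDegree ≠ 0 := not_and_or.mp hdeg
      obtain ⟨a, b, -, -, hab⟩ :=
        Polynomial.exists_mul_add_mul_eq_C_resultant p' q' le_rfl le_rfl hmn
      have key := congrArg (fun f => Polynomial.eval y (Polynomial.map (MvPolynomial.eval s) f)) hab
      simp only [Polynomial.map_add, Polynomial.map_mul, Polynomial.eval_add, Polynomial.eval_mul,
        Polynomial.map_C, Polynomial.eval_C] at key
      rw [MvPolynomial.eval_eq_eval_mv_eval', ← he] at hy hq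
      rw [← hp'] at hy
      rw [← hq'] at hq
      rw [← key, hy, hq]
      ring

/-- **Relatively prime polynomials in two variables over a field have only finitely many common
zeros.** (Folklore; e.g. W. Fulton, *Algebraic Curves*, §1.6.) -/
theorem finite_commonZeros_of_isRelPrime {p q : MvPolynomial (Fin 2) K} (hp : p ≠ 0)
    (h : IsRelPrime p q) :
    {x : Fin 2 → K | MvPolynomial.eval x p = 0 ∧ MvPolynomial.eval x q = 0}.Finite := by
  obtain ⟨r₁, hr₁, H₁⟩ := exists_eliminant hp h
  let σ : Fin 2 ≃ Fin 2 := Equiv.swap 0 1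
  have hσp : MvPolynomial.rename σ p ≠ 0 := by
    intro h0
    apply hp
    exact (MvPolynomial.rename_injective σ σ.injective) (by rw [h0, map_zero])
  have h2 : IsRelPrime (MvPolynomial.rename σ p) (MvPolynomial.rename σ q) := by
    refine IsRelPrime.of_map (MvPolynomial.renameEquiv K σ).symm ?_
    have e1 : (MvPolynomial.renameEquiv K σ).symm (MvPolynomial.rename σ p) = p := by
      change (MvPolynomial.renameEquiv K σ).symm (MvPolynomial.renameEquiv K σ p) = p
      exact AlgEquiv.symm_apply_apply _ _
    have e2 : (MvPolynomial.renameEquiv K σ).symm (MvPolynomial.rename σ q) = q := by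
      change (MvPolynomial.renameEquiv K σ).symm (MvPolynomial.renameEquiv K σ q) = q
      exact AlgEquiv.symm_apply_apply _ _
    rw [e1, e2]; exact h
  obtain ⟨r₂, hr₂, H₂⟩ := exists_eliminant hσp h2
  have fin₁ := finite_zeros_fin_one hr₁
  have fin₂ := finite_zeros_fin_one hr₂
  let Φ : (Fin 2 → K) → (Fin 1 → K) × (Fin 1 → K) := fun x => (Fin.tail x, Fin.tail (x ∘ σ))
  have hΦ : Function.Injective Φ := by
    intro x x' hxx'
    simp only [Φ, Prod.mk.injEq] at hxx'
    funext i
    fin_cases i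
    · have := congrFun hxx'.2 0
      simpa [Fin.tail, σ] using this
    · have := congrFun hxx'.1 0
      simpa [Fin.tail] using this
  refine ((fin₁.prod fin₂).preimage hΦ.injOn).subset ?_
  intro x hx
  simp only [Set.mem_setOf_eq] at hx
  simp only [Set.mem_preimage, Set.mem_prod, Set.mem_setOf_eq, Φ]
  constructor
  · apply H₁ (x 0) (Fin.tail x) <;> rw [Fin.cons_self_tail]
    · exact hx.1
    · exact hx.2
  · apply H₂ ((x ∘ σ) 0) (Fin.tail (x ∘ σ)) <;> rw [Fin.cons_self_tail, MvPolynomial.eval_rename]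
    · have : (x ∘ ⇑σ) ∘ ⇑σ = x := by funext i; simp [σ, Equiv.swap_apply_self]
      rw [this]; exact hx.1
    · have : (x ∘ ⇑σ) ∘ ⇑σ = x := by funext i; simp [σ, Equiv.swap_apply_self]
      rw [this]; exact hx.2

end Summit.Schanuel.Schanuel.Theorems.RigidCore.TwoLogs
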